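import Mathlib
import Summits.Ventures.DiscreteObjects.Mahler.FourTermMeasureBound
import Summits.Ventures.DiscreteObjects.Mahler.NonreciprocalMeasureBound
import Summits.Ventures.DiscreteObjects.Mahler.OddCoefficientsMahlerBound
import Summits.Ventures.DiscreteObjects.Mahler.SubLehmerStructure

/-!
# Polynomials congruent to `xⁿ ± 1`: `M ≥ |m|/2`, and `M² ≥ |m|` for even `m` (venture `DiscreteObjects`, target L)

Cell `pub-namedobj`, seat `pub-namedobj-mahler-g24`. Framing: lottery ticket; floor = certified
bounds/negative ranges.

A companion to Borwein–Dobrowolski–Mossinghoff's class `D_m` (all coefficients `≡ 1 (mod m)`,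
`CongruentOneCoefficients`, `OddCoefficientsMahlerBound`): the class of monic `P ∈ ℤ[X]` of degree `n`
with `P ≡ xⁿ + s (mod m)`, `s = ±1` — all middle coefficients divisible by `m`, `P(0) ≡ s`.  By the
resultant step of `FourTermMeasureBound` with the auxiliaries `xⁿ + s` and (for even `m`) `x^{2n} - 1`
(at a root `α`: `αⁿ + s = -mT(α)` and `αⁿ - s = -mT(α) - 2s`):

* `abs_le_two_mul_measure_of_congr_X_pow_add` — cyclotomic-free `P ≡ xⁿ + s (mod m)` has `|m| ≤ 2 M(P)`;
* `abs_le_measure_sq_of_congr_X_pow_add` — if moreover `m` is even, `|m| ≤ M(P)²`;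
* `sqrt_two_le_measure_of_even_middle_coeffs` — **a cyclotomic-free monic integer polynomial with odd
  constant term and all middle coefficients even has `M ≥ √2`** (`m = 2`);
* `exists_middle_coeff_not_dvd_of_irreducible_subLehmer` — hence **the middle coefficients of an
  irreducible sub-Lehmer polynomial have no common divisor `≥ 2`**; in particular
  (`exists_odd_middle_coeff_of_irreducible_subLehmer`) one of them is ODD (census reading: together with
  [BDM07] — not all coefficients odd, `not_subLehmer_of_irreducible_odd` — the middle coefficients of a
  Lehmer-ticket core are neither all even nor all odd, and not all `≡ 0 (mod m)` for any `m ≥ 2`).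

The quadrinomial/trinomial files `FourTermMeasureBound`, `ReciprocalTrinomialMeasureBound` are the cases
`T = b' x^p (x^k + s)`, `T = c' x^m`.  Method of [BDM07, Lemma 3.1] and of [Dobrowolski2006] E. Dobrowolski,
Acta Arith. 123 (2006), proof of Prop. 2 (the congruence `a ∣ αⁿ + η` and, for `a = 2`, the doubling
`2 ∣ αⁿ + η ⇒ 2 ∣ αⁿ - η`, there for quadrinomials); the statements for the whole congruence class and the
sub-Lehmer corollary are elementary consequences not found verbatim in print — PROVISIONAL wording.
-/

namespace Summit.Ventures.DiscreteObjects.Mahler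

open Polynomial

/-- If `P` is monic of degree `n ≥ 1`, `m ∣ P_i` for `0 < i < n` and `m ∣ P_0 - s`, then
`P = (xⁿ + s) + m·T` with `deg T ≤ n`. -/
theorem exists_eq_X_pow_add_C_add_C_mul {P : ℤ[X]} {m s : ℤ} (hmon : P.Monic) (hdeg : 0 < P.natDegree)
    (hmid : ∀ i, 0 < i → i < P.natDegree → m ∣ P.coeff i) (h0 : m ∣ P.coeff 0 - s) :
    ∃ T : ℤ[X], T.natDegree ≤ P.natDegree ∧ P = (X ^ P.natDegree + C s) + C m * T := by
  set n := P.natDegree with hn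
  have hcoeff : ∀ j, m ∣ (P - (X ^ n + C s)).coeff j := by
    intro j
    simp only [coeff_sub, coeff_add, coeff_X_pow, coeff_C]
    by_cases hj0 : j = 0
    · subst hj0; rw [if_neg (by omega), if_pos rfl, zero_add]; exact h0
    by_cases hjn : j = n
    · subst hjn; rw [if_pos rfl, if_neg hj0, add_zero, hmon.coeff_natDegree, sub_self]; exact dvd_zero m
    rw [if_neg hjn, if_neg hj0, add_zero, sub_zero]
    rcases lt_or_gt_of_ne hjn with hlt | hgt
    · exact hmid j (Nat.pos_of_ne_zero hj0) hlt
    · rw [coeff_eq_zero_of_natDegree_lt hgt]; exact dvd_zero m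
  obtain ⟨T, hT⟩ := (C_dvd_iff_dvd_coeff m _).mpr hcoeff
  by_cases hm0 : m = 0
  · refine ⟨0, by simp, ?_⟩
    rw [hm0, map_zero, zero_mul] at hT
    rw [hm0, map_zero, zero_mul, add_zero]
    exact (sub_eq_zero.mp hT)
  refine ⟨T, ?_, by rw [← hT]; ring⟩
  have h1 : (C m * T).natDegree = T.natDegree := natDegree_C_mul hm0
  have h2 : (P - (X ^ n + C s)).natDegree ≤ n := by
    refine (natDegree_sub_le _ _).trans (max_le le_rfl ?_)
    rw [natDegree_X_pow_add_C]
  rw [← h1, ← hT]; exact h2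

/-- **`|m| ≤ 2 M(P)`** for a cyclotomic-free monic `P ≡ xⁿ + s (mod m)` (`s = ±1`, `n ≥ 1`): auxiliary
`xⁿ + s = P - mT`, `|αⁿ + s| ≤ 2 max(1,|α|)ⁿ`. -/
theorem abs_le_two_mul_measure_of_congr_X_pow_add {P : ℤ[X]} {m s : ℤ} (hs : s = 1 ∨ s = -1)
    (hmon : P.Monic) (hdeg : 0 < P.natDegree) (hmid : ∀ i, 0 < i → i < P.natDegree → m ∣ P.coeff i)
    (h0 : m ∣ P.coeff 0 - s) (hcf : ∀ k : ℕ, 0 < k → ¬ cyclotomic k ℤ ∣ P) :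
    (|m| : ℝ) ≤ 2 * intMahlerMeasure P := by
  obtain ⟨T, _, hPT⟩ := exists_eq_X_pow_add_C_add_C_mul hmon hdeg hmid h0
  set n := P.natDegree with hn
  have hP0 : P ≠ 0 := hmon.ne_zero
  have hG : (X ^ n + C s : ℤ[X]) = C m * (-T) + P * 1 := by rw [hPT]; ring
  have hGdeg : (X ^ n + C s : ℤ[X]).natDegree ≤ n := by rw [natDegree_X_pow_add_C]
  have hne : P.resultant (X ^ n + C s) P.natDegree n ≠ 0 := by
    refine resultant_ne_zero_of_cyclotomicFree (L := 2 * n) hP0 hcf hGdeg (by omega) ?_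
    intro z hz
    simp only [Polynomial.map_add, Polynomial.map_pow, map_X, eq_intCast, Polynomial.map_intCast,
      eval_add, eval_pow, eval_X, eval_intCast] at hz
    have hz' : z ^ n = -(s : ℂ) := eq_neg_of_add_eq_zero_left hz
    rw [pow_mul', hz', neg_sq]
    rcases hs with h | h <;> simp [h]
  have hroot : ∀ α : ℂ, ‖((X ^ n + C s : ℤ[X]).map (Int.castRingHom ℂ)).eval α‖ ≤ 2 * max 1 ‖α‖ ^ n := by
    intro α
    simp only [Polynomial.map_add, Polynomial.map_pow, map_X, eq_intCast, Polynomial.map_intCast,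
      eval_add, eval_pow, eval_X, eval_intCast]
    exact norm_pow_add_le_two_mul α (s : ℂ) (norm_intCast_le_one_of_sign hs) n
  have h := abs_pow_le_pow_mul_measure_pow_of_resultant (K := 2) hG (by rw [natDegree_one]; omega)
    hGdeg hne hroot
  rw [← hn, ← mul_pow] at h
  have hM0 : 0 ≤ 2 * intMahlerMeasure P := by have := one_le_intMahlerMeasure hP0; linarith
  exact le_of_pow_le_pow_left₀ (by omega) hM0 h

/-- **`|m| ≤ M(P)²`** for a cyclotomic-free monic `P ≡ xⁿ + s (mod m)` with `m` EVEN: `m = 2c`,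
`x^{2n} - 1 = 4c·T(cT + s) + P·(P - 4cT - 2s)`, `|α^{2n} - 1| ≤ 2 max(1,|α|)^{2n}`. -/
theorem abs_le_measure_sq_of_congr_X_pow_add {P : ℤ[X]} {m s : ℤ} (hs : s = 1 ∨ s = -1) (hm : Even m)
    (hmon : P.Monic) (hdeg : 0 < P.natDegree) (hmid : ∀ i, 0 < i → i < P.natDegree → m ∣ P.coeff i)
    (h0 : m ∣ P.coeff 0 - s) (hcf : ∀ k : ℕ, 0 < k → ¬ cyclotomic k ℤ ∣ P) :
    (|m| : ℝ) ≤ intMahlerMeasure P ^ 2 := by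
  obtain ⟨T, hTdeg, hPT⟩ := exists_eq_X_pow_add_C_add_C_mul hmon hdeg hmid h0
  set n := P.natDegree with hn
  have hP0 : P ≠ 0 := hmon.ne_zero
  obtain ⟨c, hc⟩ := hm
  have hss : s * s = 1 := by rcases hs with h | h <;> simp [h]
  have hCs : (C s : ℤ[X]) * C s = 1 := by rw [← map_mul, hss, map_one]
  have hG : (X ^ (2 * n) - 1 : ℤ[X]) = C (4 * c) * (T * (C c * T + C s)) + P * (P - C (4 * c) * T - C (2 * s)) := by
    have e : P - C (4 * c) * T - C (2 * s) = X ^ n - C (2 * c) * T - C s := by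
      rw [hPT, hc]; simp only [map_add, map_mul, map_ofNat]; ring
    rw [e, hPT, hc]
    simp only [map_add, map_mul, map_ofNat]
    linear_combination hCs
  have hGdeg : (X ^ (2 * n) - 1 : ℤ[X]).natDegree ≤ 2 * n := by rw [← C_1, natDegree_X_pow_sub_C]
  have hne : P.resultant (X ^ (2 * n) - 1) P.natDegree (2 * n) ≠ 0 :=
    resultant_X_pow_sub_one_ne_zero hP0 hcf (by omega)
  have hHdeg : (P - C (4 * c) * T - C (2 * s)).natDegree + P.natDegree ≤ 2 * n := by
    have h1 : (P - C (4 * c) * T - C (2 * s)).natDegree ≤ n := by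
      refine (natDegree_sub_le _ _).trans (max_le ((natDegree_sub_le _ _).trans (max_le le_rfl ?_)) ?_)
      · exact (natDegree_C_mul_le _ _).trans hTdeg
      · rw [natDegree_C]; omega
    omega
  have hroot : ∀ α : ℂ, ‖((X ^ (2 * n) - 1 : ℤ[X]).map (Int.castRingHom ℂ)).eval α‖ ≤ 2 * max 1 ‖α‖ ^ (2 * n) := by
    intro α
    simp only [Polynomial.map_sub, Polynomial.map_pow, map_X, Polynomial.map_one, eval_sub, eval_pow,
      eval_X, eval_one]
    have := norm_pow_add_le_two_mul α (-1) (by simp) (2 * n)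
    rwa [← sub_eq_add_neg] at this
  have h := abs_pow_le_pow_mul_measure_pow_of_resultant (K := 2) hG hHdeg hGdeg hne hroot
  rw [← hn, pow_mul (intMahlerMeasure P) 2 n, ← mul_pow] at h
  have hM0 : 0 ≤ 2 * intMahlerMeasure P ^ 2 := by positivity
  have h2 := le_of_pow_le_pow_left₀ (by omega : n ≠ 0) hM0 h
  have h4 : (|((4 : ℤ) * c : ℤ)| : ℝ) = 4 * |(c : ℝ)| := by push_cast; rw [abs_mul]; norm_num
  have h5 : (|m| : ℝ) = 2 * |(c : ℝ)| := by rw [hc]; push_cast; rw [← two_mul, abs_mul, abs_two]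
  rw [h4] at h2; rw [h5]; linarith

/-- **Even middle coefficients.**  A cyclotomic-free monic `P ∈ ℤ[X]` of degree `≥ 1` with odd constant
term and all coefficients strictly between the constant and the leading one EVEN has `M(P) ≥ √2`. -/
theorem sqrt_two_le_measure_of_even_middle_coeffs {P : ℤ[X]} (hmon : P.Monic) (hdeg : 0 < P.natDegree)
    (hmid : ∀ i, 0 < i → i < P.natDegree → Even (P.coeff i)) (h0 : Odd (P.coeff 0))
    (hcf : ∀ k : ℕ, 0 < k → ¬ cyclotomic k ℤ ∣ P) : Real.sqrt 2 ≤ intMahlerMeasure P := by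
  have h0' : (2 : ℤ) ∣ P.coeff 0 - 1 := by
    obtain ⟨j, hj⟩ := h0; exact ⟨j, by omega⟩
  have hmid' : ∀ i, 0 < i → i < P.natDegree → (2 : ℤ) ∣ P.coeff i :=
    fun i hi hi' => even_iff_two_dvd.mp (hmid i hi hi')
  have h := abs_le_measure_sq_of_congr_X_pow_add (s := 1) (Or.inl rfl) ⟨1, rfl⟩ hmon hdeg hmid' h0' hcf
  have h2 : (2 : ℝ) ≤ intMahlerMeasure P ^ 2 := by simpa using h
  have hM0 : 0 ≤ intMahlerMeasure P := by have := one_le_intMahlerMeasure hmon.ne_zero; linarith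
  calc Real.sqrt 2 ≤ Real.sqrt (intMahlerMeasure P ^ 2) := Real.sqrt_le_sqrt h2
    _ = intMahlerMeasure P := Real.sqrt_sq hM0

/-- **The middle coefficients of an irreducible sub-Lehmer polynomial have no common divisor:** for every
integer `m` with `|m| ≥ 2` some coefficient `P_i`, `0 < i < deg P`, is NOT divisible by `m`.  (`P` is monic up
to sign with `P(0) = ±1` and cyclotomic-free; if all middle coefficients were `≡ 0 (mod m)` then
`M(P) ≥ |m|/2 ≥ 3/2` for `|m| ≥ 3` and `M(P) ≥ √2` for `|m| = 2`.) -/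
theorem exists_middle_coeff_not_dvd_of_irreducible_subLehmer {P : ℤ[X]} (hirr : Irreducible P)
    (hP : SubLehmer P) {m : ℤ} (hm : 2 ≤ |m|) : ∃ i, 0 < i ∧ i < P.natDegree ∧ ¬ m ∣ P.coeff i := by
  by_contra hno
  push Not at hno
  have hL := lehmer_measure_upper_bound
  have h1 := hP.1
  have h2 := hP.2
  have hP0 : P ≠ 0 := hirr.ne_zero
  have hcf := cyclotomicFree_of_irreducible_of_one_lt hirr h1
  have hc0P : P.coeff 0 ≠ 0 := core_coeff_zero_ne_zero hirr hP
  -- leading coefficient `± 1`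
  have hlc : |P.leadingCoeff| = 1 := by
    have h := abs_leadingCoeff_le_intMahlerMeasure P
    have hne : P.leadingCoeff ≠ 0 := leadingCoeff_ne_zero.mpr hP0
    have h1' := Int.one_le_abs hne
    by_contra hc
    have : (2 : ℤ) ≤ |P.leadingCoeff| := by omega
    have : (2 : ℝ) ≤ |(P.leadingCoeff : ℝ)| := by exact_mod_cast this
    linarith
  -- degree `≥ 1`
  have hdeg : 0 < P.natDegree := by
    by_contra hd
    have hd0 : P.natDegree = 0 := by omega
    rw [eq_C_of_natDegree_eq_zero hd0, intMahlerMeasure_C] at h1 h2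
    have : (2 : ℝ) ≤ |(P.coeff 0 : ℝ)| := by
      have h1' : (1 : ℤ) < |P.coeff 0| := by exact_mod_cast h1
      have : (2 : ℤ) ≤ |P.coeff 0| := h1'
      exact_mod_cast this
    linarith
  -- reduce to the monic polynomial `Q = ± P`
  obtain ⟨Q, hQm, hQM, hQc, hQcf, hQdeg⟩ : ∃ Q : ℤ[X], Q.Monic ∧ intMahlerMeasure Q = intMahlerMeasure P ∧
      (∀ i, Q.coeff i = P.coeff i ∨ Q.coeff i = -P.coeff i) ∧ (∀ k : ℕ, 0 < k → ¬ cyclotomic k ℤ ∣ Q) ∧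
      Q.natDegree = P.natDegree := by
    rcases (abs_eq (zero_le_one' ℤ)).mp hlc with h | h
    · exact ⟨P, h, rfl, fun i => Or.inl rfl, hcf, rfl⟩
    · refine ⟨-P, by rw [Monic, leadingCoeff_neg, h, neg_neg], intMahlerMeasure_neg P,
        fun i => Or.inr (coeff_neg P i), fun k hk hd => hcf k hk (dvd_neg.mp hd), natDegree_neg P⟩
  have hmidQ : ∀ i, 0 < i → i < Q.natDegree → m ∣ Q.coeff i := by
    intro i hi hi'
    rw [hQdeg] at hi'
    rcases hQc i with h | h <;> rw [h]
    · exact hno i hi hi'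
    · exact (hno i hi hi').neg_right
  -- `Q(0) = s = ± 1`
  obtain ⟨s, hs, hQ0⟩ : ∃ s : ℤ, (s = 1 ∨ s = -1) ∧ Q.coeff 0 = s := by
    have hb := abs_coeff_zero_le_intMahlerMeasure hQm
    rw [hQM] at hb
    have hne : Q.coeff 0 ≠ 0 := by
      rcases hQc 0 with h | h <;> rw [h]
      · exact hc0P
      · exact neg_ne_zero.mpr hc0P
    have hlt : |Q.coeff 0| < 2 := by
      have : |(Q.coeff 0 : ℝ)| < 2 := by linarith
      exact_mod_cast this
    have habs : |Q.coeff 0| = 1 := le_antisymm (by omega) (Int.one_le_abs hne)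
    exact ⟨Q.coeff 0, (abs_eq (zero_le_one' ℤ)).mp habs, rfl⟩
  have h0 : m ∣ Q.coeff 0 - s := by rw [hQ0, sub_self]; exact dvd_zero m
  have hdegQ : 0 < Q.natDegree := by rw [hQdeg]; exact hdeg
  have hA := abs_le_two_mul_measure_of_congr_X_pow_add hs hQm hdegQ hmidQ h0 hQcf
  rw [hQM] at hA
  -- `|m| ≤ 2M < 2.36`, so `|m| = 2`, `m` even: then `|m| ≤ M² < 1.39`, contradiction
  have hm2 : |m| = 2 := by
    have : (|m| : ℝ) < 3 := by linarith
    have : |m| < 3 := by exact_mod_cast this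
    omega
  have heven : Even m := by
    rcases abs_choice m with h | h <;> rw [h] at hm2
    · exact ⟨1, by omega⟩
    · exact ⟨-1, by omega⟩
  have hB := abs_le_measure_sq_of_congr_X_pow_add hs heven hQm hdegQ hmidQ h0 hQcf
  have hm2R : |(m : ℝ)| = 2 := by exact_mod_cast hm2
  rw [hQM, hm2R] at hB
  have hM0 : 0 ≤ intMahlerMeasure P := by linarith [one_le_intMahlerMeasure hP0]
  nlinarith

/-- **An irreducible sub-Lehmer polynomial has an odd middle coefficient** (`m = 2`). -/
theorem exists_odd_middle_coeff_of_irreducible_subLehmer {P : ℤ[X]} (hirr : Irreducible P) (hP : SubLehmer P) :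
    ∃ i, 0 < i ∧ i < P.natDegree ∧ Odd (P.coeff i) := by
  obtain ⟨i, hi, hi', hnd⟩ := exists_middle_coeff_not_dvd_of_irreducible_subLehmer hirr hP (m := 2) (by norm_num)
  exact ⟨i, hi, hi', Int.not_even_iff_odd.mp (fun h => hnd (even_iff_two_dvd.mp h))⟩

end Summit.Ventures.DiscreteObjects.Mahler
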